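import Mathlib

/-!
# Costate toolbox (idea `maurer-cartan-costate`) for crux `ElementaryWordLength.WordPerSuperQuartic`
# (stmt-ValiantsHypothesis-6624) — STATEMENTS ONLY, in the tree's CHAIN model

Crux-plan seat `cruxplan-stmt-ValiantsHypothesis-6624-maurer-cartan-costat`, 2026-08-17.  Outcome of the seat:
**no-skeleton** (the costate identity is an exact reformulation of "w is a word for E₀₂(f)"; no composition to the
crux by name exists that is neither a costume nor line `imm-packing-product-tax` — see
`Lines/maurer-cartan-costate-dead.md`).  What the idea DOES contribute is the calculus below, typed here over the
chain vocabulary already landed under `Theorems/ElementaryWordLengthWordPerSuperQuartic*.lean`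
(`chain_read_once` p112552 = two reads; `chain_sum_reads_eq` p109728 = first-order costate identity;
`stub_chainNormalForm` p108980 = word → chain; `stub_squareZeroFactor` p116340 = `N² = 0 ⇒ N = a bᵀ, bᵀa = 0`),
so that the imm line (triage r1: "fold maurerCartan / two_reads / the arc lemma in as helper stubs of the imm
line") or a later lead can adopt them verbatim.  Every statement was derived by hand in this seat's NOTES.md;
T1–T4, T6 are expected TRUE (T6 matches kit j017569 and the free-constant numerics j021662); proofs are
deliberately `sorry` (planner seat: statements, not proofs).

A *chain* is `Π_t (1 + x_{v_t} • N_t)` over letters `(v_t, N_t) : σ × Matrix (Fin 3) (Fin 3) ℂ` with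
`N_t² = 0`; it has determinant one, so inverse = adjugate.

* T1 `twoRead_identities` — the x_i⁰ / x_i¹ / x_i² coefficient identities at a variable read exactly twice
  (the costate identity `dW·W⁻¹ = d(per)·e₀₂` restricted to one variable, written without inverses).
* T2 `arc_lemma` — RIGIDITY at a twice-read variable: the two costate letters `u₁w₁ᵀ + u₂w₂ᵀ = g·e₀e₂ᵀ` are
  unimodular rank-one, so columns or rows are parallel, and parallel unimodular vectors over `ℂ[x']` differ by
  a unit `θ ∈ ℂˣ`; consequence: the middle arc transports one side CLEANLY (`B a₂ = θ a₁` or `b₁ᵀB = θ⁻¹b₂ᵀ`)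
  and "twisted-computes" `g = ∂_i P'` on the dual side, and so does the outer arc.  (Ben-Or–Cleve's
  there-and-back as a theorem; the loophole the 8-letter word uses.)
* T3 `read_localisation` (+ `_transvection`) — ALL orders at once: conjugating away the `i`-free arcs turns a
  chain into the product of the COSTATE LETTERS `M_k = P_k N_k P_k⁻¹` of the reads of `i` times the `i`-deleted
  chain; if the chain computes `E₀₂(P')`, the `r` reads of `i` form a length-`r` chain over `ℂ[x']` computing
  `E₀₂(P' − P'|_{x_i=0})`.  `r = 1` is two-reads, `r = 2` is T1/T2; `r ≥ 3` is where rigidity is NOT rigid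
  (triage r1-3: the (2,4,2) gadget), i.e. where any product-tax engine has to work.
* T4 `twisted_pair_row` / `twisted_pair_col` — calibration atom: a chain with ≤ 2 letters cannot
  twisted-compute a product of two distinct variables (`ρ ≠ 0`).  With T2 and `chain_read_once` this gives
* T6 `chain_xyz_ge_eight` — every chain computing `E₀₂(x₀x₁x₂)` has ≥ 8 letters (free constants), the
  first exact-length lower bound beyond the two-reads floor 6; attained (`eight_letter_word`, ShortWords.lean).

Not typed (deliberately): the cubic twisted cost ≥ 5 (⇒ ν(x₀x₁x₂x₃) = 12; sketch only, Ideator1Notes §2),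
any "potential on the costate orbit" (none is known that is not the word metric itself), MonomialExponent.
-/

set_option linter.dupNamespace false
set_option linter.unusedVariables false

namespace Summit.ValiantsHypothesis.ValiantsHypothesis.Cruxes.WordPerSuperQuartic.MaurerCartanCostate

open MvPolynomial Matrix

noncomputable section

variable {σ : Type}

/-- The factor `1 + x_v • N` of a chain letter `(v, N)` — verbatim the tree's inline term. -/
abbrev factor (e : σ × Matrix (Fin 3) (Fin 3) ℂ) : Matrix (Fin 3) (Fin 3) (MvPolynomial σ ℂ) :=
  (1 : Matrix (Fin 3) (Fin 3) (MvPolynomial σ ℂ)) +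
    (MvPolynomial.X e.1 : MvPolynomial σ ℂ) • e.2.map (MvPolynomial.C : ℂ → MvPolynomial σ ℂ)

/-- The chain `Π_t (1 + x_{v_t} • N_t)` of a list of letters — verbatim the tree's inline term. -/
abbrev chain (L : List (σ × Matrix (Fin 3) (Fin 3) ℂ)) : Matrix (Fin 3) (Fin 3) (MvPolynomial σ ℂ) :=
  (L.map factor).prod

/-- The tree's inline chain term and `chain` agree (so the statements below can be pasted next to
`chain_read_once`, `chain_sum_reads_eq`, `wordPerSuperQuartic_of_patternChainHardness`). -/
theorem chain_eq_inline (L : List (σ × Matrix (Fin 3) (Fin 3) ℂ)) :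
    chain L = (L.map (fun e => (1 : Matrix (Fin 3) (Fin 3) (MvPolynomial σ ℂ)) +
        (MvPolynomial.X e.1 : MvPolynomial σ ℂ) •
          e.2.map (MvPolynomial.C : ℂ → MvPolynomial σ ℂ))).prod := rfl

/-! ## T1 — two-read costate identities -/

/-- **T1 · two-read costate identities.**  Let the variable `i` be read exactly twice, by the letters
`(i, N₁)` and `(i, N₂)`, with `i`-free arcs `L₀, L₁, L₂` (chains `A, B, C`), and let the chain compute
`E₀₂(f₀ + x_i·g)` with `f₀, g` free of `x_i`.  Comparing `x_i`-degrees (`A, B, C` are invertible with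
inverse = adjugate):  `A B C = E₀₂(f₀)`,  `A N₁ A⁻¹ + (AB) N₂ (AB)⁻¹ = g·e₀₂`  (the costate identity for `i`),
`N₁ B N₂ = 0`.  Lean size: M (coefficient extraction as in `chain_read_once`; `det = 1`). -/
theorem twoRead_identities [DecidableEq σ] (i : σ) (L₀ L₁ L₂ : List (σ × Matrix (Fin 3) (Fin 3) ℂ))
    (N₁ N₂ : Matrix (Fin 3) (Fin 3) ℂ)
    (h₀ : ∀ e ∈ L₀, e.1 ≠ i) (h₁ : ∀ e ∈ L₁, e.1 ≠ i) (h₂ : ∀ e ∈ L₂, e.1 ≠ i)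
    (hsq : ∀ e ∈ L₀ ++ (i, N₁) :: (L₁ ++ (i, N₂) :: L₂), e.2 * e.2 = 0)
    (f₀ g : MvPolynomial σ ℂ) (hf₀ : i ∉ f₀.vars) (hg : i ∉ g.vars)
    (hchain : chain (L₀ ++ (i, N₁) :: (L₁ ++ (i, N₂) :: L₂)) =
      Matrix.transvection (0 : Fin 3) 2 (f₀ + X i * g)) :
    chain L₀ * chain L₁ * chain L₂ = Matrix.transvection (0 : Fin 3) 2 f₀ ∧
    chain L₀ * N₁.map (C : ℂ → MvPolynomial σ ℂ) * (chain L₀).adjugate +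
        (chain L₀ * chain L₁) * N₂.map (C : ℂ → MvPolynomial σ ℂ) * (chain L₀ * chain L₁).adjugate =
      Matrix.single (0 : Fin 3) 2 g ∧
    N₁.map (C : ℂ → MvPolynomial σ ℂ) * chain L₁ * N₂.map (C : ℂ → MvPolynomial σ ℂ) = 0 := by
  sorry

/-! ## T2 — the arc lemma (rigidity at a twice-read variable) -/

/-- **T2 · arc lemma.**  In the situation of T1 with rank-one letters `N₁ = a₁b₁ᵀ`, `N₂ = a₂b₂ᵀ`
(`bₖᵀaₖ = 0`, all four constant vectors nonzero — `stub_squareZeroFactor`) and `g ≠ 0`: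
EITHER (column type) there are `θ, α ∈ ℂˣ` with
`A a₁ = α e₀`, `B a₂ = θ a₁` (clean column transport through the middle arc),
`b₁ᵀ B = −θ b₂ᵀ + (g/α)·row₂(AB)` and `b₂ᵀ (C A) = −θ⁻¹ b₁ᵀ + (g/(θα))·row₂(A)` (both arcs
twisted-compute `g` on rows, with UNIMODULAR polynomial rows),
OR (row type) the transposed picture: `b₁ᵀ A⁻¹ = β e₂ᵀ`, `b₁ᵀ B = θ⁻¹ b₂ᵀ`,
`B a₂ = −θ⁻¹ a₁ + (g/(βθ))·col₀(A⁻¹)`, `(C A) a₁ = −θ a₂ + (g/β)·col₀((AB)⁻¹)`.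
Proof route (M): T1; `u₁w₁ᵀ + u₂w₂ᵀ = g e₀e₂ᵀ` with `uₖ, wₖ` unimodular over the domain `ℂ[x]`
⇒ columns or rows parallel (rank count over the fraction field) ⇒ proportional by a unit of
`MvPolynomial σ ℂ`, i.e. a nonzero constant (`MvPolynomial.isUnit_iff_eq_C_of_isReduced`); then solve. -/
theorem arc_lemma [DecidableEq σ] (i : σ) (L₀ L₁ L₂ : List (σ × Matrix (Fin 3) (Fin 3) ℂ))
    (a₁ b₁ a₂ b₂ : Fin 3 → ℂ) (ha₁ : a₁ ≠ 0) (hb₁ : b₁ ≠ 0) (ha₂ : a₂ ≠ 0) (hb₂ : b₂ ≠ 0)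
    (hab₁ : dotProduct b₁ a₁ = 0) (hab₂ : dotProduct b₂ a₂ = 0)
    (h₀ : ∀ e ∈ L₀, e.1 ≠ i) (h₁ : ∀ e ∈ L₁, e.1 ≠ i) (h₂ : ∀ e ∈ L₂, e.1 ≠ i)
    (hsq : ∀ e ∈ L₀ ++ L₁ ++ L₂, e.2 * e.2 = 0)
    (f₀ g : MvPolynomial σ ℂ) (hf₀ : i ∉ f₀.vars) (hg : i ∉ g.vars) (hg0 : g ≠ 0)
    (hchain : chain (L₀ ++ (i, vecMulVec a₁ b₁) :: (L₁ ++ (i, vecMulVec a₂ b₂) :: L₂)) =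
      Matrix.transvection (0 : Fin 3) 2 (f₀ + X i * g)) :
    (∃ θ α : ℂ, θ ≠ 0 ∧ α ≠ 0 ∧
        chain L₀ *ᵥ (fun k => (C (a₁ k) : MvPolynomial σ ℂ)) = Pi.single (0 : Fin 3) (C α) ∧
        chain L₁ *ᵥ (fun k => (C (a₂ k) : MvPolynomial σ ℂ)) = (C θ : MvPolynomial σ ℂ) • (fun k => (C (a₁ k) : MvPolynomial σ ℂ)) ∧
        (fun k => (C (b₁ k) : MvPolynomial σ ℂ)) ᵥ* chain L₁ =
          -((C θ : MvPolynomial σ ℂ) • fun k => (C (b₂ k) : MvPolynomial σ ℂ)) + (C α⁻¹ * g) • (fun j => (chain L₀ * chain L₁) 2 j) ∧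
        (fun k => (C (b₂ k) : MvPolynomial σ ℂ)) ᵥ* (chain L₂ * chain L₀) =
          -((C θ⁻¹ : MvPolynomial σ ℂ) • fun k => (C (b₁ k) : MvPolynomial σ ℂ)) + (C (θ * α)⁻¹ * g) • (fun j => chain L₀ 2 j)) ∨
    (∃ θ β : ℂ, θ ≠ 0 ∧ β ≠ 0 ∧
        (fun k => (C (b₁ k) : MvPolynomial σ ℂ)) ᵥ* (chain L₀).adjugate = Pi.single (2 : Fin 3) (C β) ∧
        (fun k => (C (b₁ k) : MvPolynomial σ ℂ)) ᵥ* chain L₁ = (C θ⁻¹ : MvPolynomial σ ℂ) • (fun k => (C (b₂ k) : MvPolynomial σ ℂ)) ∧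
        chain L₁ *ᵥ (fun k => (C (a₂ k) : MvPolynomial σ ℂ)) =
          -((C θ⁻¹ : MvPolynomial σ ℂ) • fun k => (C (a₁ k) : MvPolynomial σ ℂ)) + (C (β * θ)⁻¹ * g) • (fun j => (chain L₀).adjugate j 0) ∧
        (chain L₂ * chain L₀) *ᵥ (fun k => (C (a₁ k) : MvPolynomial σ ℂ)) =
          -((C θ : MvPolynomial σ ℂ) • fun k => (C (a₂ k) : MvPolynomial σ ℂ)) + (C β⁻¹ * g) • (fun j => (chain L₀ * chain L₁).adjugate j 0)) := by
  sorry

/-! ## T3 — read localisation (the costate identity at all orders) -/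

/-- The COSTATE LETTERS of the reads of `i` along a list, given the running `i`-free prefix `A`
(a chain, so `A⁻¹ = adj A`): at a letter `(i, N)` emit `A · N · adj A`; at any other letter `e`
advance `A ↦ A · (1 + x_{e.1} • e.2)`. -/
def costates [DecidableEq σ] (i : σ) :
    List (σ × Matrix (Fin 3) (Fin 3) ℂ) → Matrix (Fin 3) (Fin 3) (MvPolynomial σ ℂ) →
      List (Matrix (Fin 3) (Fin 3) (MvPolynomial σ ℂ))
  | [], _ => []
  | e :: L, A =>
      if e.1 = i then (A * e.2.map (C : ℂ → MvPolynomial σ ℂ) * A.adjugate) :: costates i L A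
      else costates i L (A * factor e)

/-- **T3 · read localisation.**  A chain of square-zero letters equals the product of the factors
`1 + x_i • M_k` over the costate letters `M_k` of the reads of `i` (in order), times the `i`-deleted chain:
conjugate every `i`-free arc to the right (`det = 1`, inverse = adjugate).  `r = 1` read gives
`chain_read_once`; `r = 2` reads give T1. -/
theorem read_localisation [DecidableEq σ] (i : σ) (L : List (σ × Matrix (Fin 3) (Fin 3) ℂ))
    (hsq : ∀ e ∈ L, e.2 * e.2 = 0) :
    chain L = ((costates i L 1).map fun M => (1 : Matrix (Fin 3) (Fin 3) (MvPolynomial σ ℂ)) +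
        (X i : MvPolynomial σ ℂ) • M).prod * chain (L.filter fun e => e.1 ≠ i) := by
  sorry

/-- **T3' · the reads of one variable are a short chain over the bigger ring.**  If the chain computes
`E₀₂(P')`, then the `r` costate letters of the reads of `i` form a length-`r` "chain over `ℂ[x']`"
computing `E₀₂(P' − P'|_{x_i = 0})` (for multilinear `P'`: `E₀₂(x_i · ∂_i P')`).  All the rigidity the
costate card proves is the analysis of such chains for `r ≤ 2`; `r ≥ 3` is open (not rigid: the
(2,4,2) gadget `transvection_triple_product`). -/
theorem read_localisation_transvection [DecidableEq σ] (i : σ)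
    (L : List (σ × Matrix (Fin 3) (Fin 3) ℂ)) (hsq : ∀ e ∈ L, e.2 * e.2 = 0)
    (P' : MvPolynomial σ ℂ) (hL : chain L = Matrix.transvection (0 : Fin 3) 2 P') :
    ((costates i L 1).map fun M => (1 : Matrix (Fin 3) (Fin 3) (MvPolynomial σ ℂ)) +
        (X i : MvPolynomial σ ℂ) • M).prod =
      Matrix.transvection (0 : Fin 3) 2
        (P' - MvPolynomial.aeval (fun j : σ => if j = i then (0 : MvPolynomial σ ℂ) else X j) P') := by
  sorry

/-! ## T4 — calibration atom: twisted cost of a pair is ≥ 3 -/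

/-- **T4 (row form).**  No chain with at most two letters twisted-computes a product of two distinct
variables on rows: `b₁ᵀ · chain B ≠ −θ b₂ᵀ + x_u x_v · ρᵀ` whenever `ρ ≠ 0` (degree count: the linear
terms force `b₁ᵀN = b₁ᵀN' = 0`, which kills the quadratic term).  Three letters suffice
(`E₂₁(−x_u)E₃₂(x_v)E₂₁(x_u)` type, `twisted_three_letters` of TRIAGE-r1-1), versus 4 for the clean `E₀₂(x_u x_v)`. -/
theorem twisted_pair_row (u v : σ) (huv : u ≠ v) (B : List (σ × Matrix (Fin 3) (Fin 3) ℂ))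
    (hB : B.length ≤ 2) (hsq : ∀ e ∈ B, e.2 * e.2 = 0) (b₁ b₂ : Fin 3 → ℂ) (θ : ℂ)
    (ρ : Fin 3 → MvPolynomial σ ℂ) (hρ : ρ ≠ 0) :
    (fun k => (C (b₁ k) : MvPolynomial σ ℂ)) ᵥ* chain B ≠ -((C θ : MvPolynomial σ ℂ) • fun k => (C (b₂ k) : MvPolynomial σ ℂ)) + ((X u * X v : MvPolynomial σ ℂ)) • ρ := by
  sorry

/-- **T4 (column form)** — the transpose of `twisted_pair_row`. -/
theorem twisted_pair_col (u v : σ) (huv : u ≠ v) (B : List (σ × Matrix (Fin 3) (Fin 3) ℂ))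
    (hB : B.length ≤ 2) (hsq : ∀ e ∈ B, e.2 * e.2 = 0) (a₁ a₂ : Fin 3 → ℂ) (θ : ℂ)
    (ρ : Fin 3 → MvPolynomial σ ℂ) (hρ : ρ ≠ 0) :
    chain B *ᵥ (fun k => (C (a₂ k) : MvPolynomial σ ℂ)) ≠ -((C θ : MvPolynomial σ ℂ) • fun k => (C (a₁ k) : MvPolynomial σ ℂ)) + ((X u * X v : MvPolynomial σ ℂ)) • ρ := by
  sorry

/-! ## T6 — the first exact-length bound beyond two reads -/

/-- **T6 · `ν(x₀x₁x₂) = 8` (lower half; free constants).**  Every chain of square-zero letters computing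
`E₀₂(x₀x₁x₂)` has at least 8 letters.  Proof route (M): with ≤ 7 letters some variable is read ≤ 2 times;
once is impossible (`chain_read_once`: its derivative `x₁x₂` is not constant; a zero letter `N = 0` can be
deleted); twice ⇒ T2 ⇒ both arcs twisted-compute `x_u x_v` with a row/column of an `SL₃` matrix as `ρ`
(nonzero) ⇒ T4 ⇒ each arc has ≥ 3 letters ⇒ `2 + 3 + 3 = 8`.  Upper half: `eight_letter_word`
(ShortWords.lean, kernel-checked) — so 8 is exact; kit j017569 confirms in the ±1 model, j021662 numerically
with free constants.  By `chain_to_word`/`stub_chainNormalForm` this is `ν(E₀₂(x₀x₁x₂)) = 8` for words. -/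
theorem chain_xyz_ge_eight (L : List (Fin 3 × Matrix (Fin 3) (Fin 3) ℂ)) (hsq : ∀ e ∈ L, e.2 * e.2 = 0)
    (hL : chain L = Matrix.transvection (0 : Fin 3) 2
      ((X 0 : MvPolynomial (Fin 3) ℂ) * X 1 * X 2)) :
    8 ≤ L.length := by
  sorry

end

end Summit.ValiantsHypothesis.ValiantsHypothesis.Cruxes.WordPerSuperQuartic.MaurerCartanCostate
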